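import Literature.NumberTheory.EllipticCurves.ZpExtensionCoeffAdicTower
import Literature.NumberTheory.EllipticCurves.ZpExtensionEisensteinSelmerStructureProofs
import Literature.NumberTheory.GaloisCohomology.Howard2004.SelmerTriples
import HarnessLib

/-!
# The Selmer structure `𝓕_Λ` of Howard / Castella–Grossi–Lee–Skinner on the levels `M_k ⊗ (Λ/I_k)(χ)` of a
# `Λ`-adic tower (`ZpExtension.coeffAdicTower`), level by level, PROPAGATED from the compact `𝐓`
# (definitions with bodies + unfolding / compatibility theorems; no named fact, no instance, no notation)

Topic `NumberTheory/EllipticCurves` (sequel of `ZpExtensionCoeffAdicTower` (the `Λ`-adic tower of seat x9-p2) and of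
`ZpExtensionEisensteinSelmerStructure` (the D1 road's `F_𝔮`); cell `pub/bsd-print-x9`, literature seat, TRANCHE 5
= the SOURCE setting on which Castella–Grossi–Lee–Skinner 2022 Thm. 4.1.1 («there exists a Kolyvagin system
`κ^{Hg} ∈ 𝐊𝐒(𝐓, 𝓕_Λ, 𝓛_E)` …») is typed).

PRINT.  Howard [*The Heegner point Kolyvagin system*, Compositio 140 (2004), Def. 2.2.6 = arXiv:1202.6340
Def. 3.2.6, p0016 L104–110]: «Define a Selmer structure `𝓕_Λ` on `𝐓` by taking the unramified condition at primes of
`K` not dividing `p`, and taking the image of `H¹(K_v, Fil_v 𝐓) → H¹(K_v, 𝐓)` at primes above `p`», with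
`Fil_v 𝐓 = lim← Ind_{K_n/K} Fil_v T` [Def. 2.2.5, p0016 L84–100].  Castella–Grossi–Lee–Skinner [Invent. math. 227
(2022), §3.4 = arXiv:2008.02571v2 TeX L2102–2108]: «`H¹_{𝓕_Λ}(K_w, 𝐓) := im{H¹(K_w, Fil_w⁺ 𝐓) → H¹(K_w, 𝐓)}` if
`w ∣ p`, `H¹(K_w, 𝐓)` else» for `w ∈ Σ`, `Σ ⊇ {∞, w ∣ p, primes where 𝐓 is ramified}` [§3.1, v1 p0014 L9–13],
`Σ(𝓕_ord) = {w ∣ pN}` [§3.2, v1 p0015 L7].  A Kolyvagin system for `(𝐓, 𝓕_Λ, 𝓛)` lives on the finite quotients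
`𝐓/I_n𝐓` with the conditions PROPAGATED from `𝐓` [Howard Def. 1.1.3 / Rem. 1.2.4 (iii): «`𝓕 ⊗_R R′` is defined as
the image of `H¹_𝓕(K_v, T) ⊗_R R′ → H¹(K_v, T ⊗_R R′)`», arXiv p. 7 L19–27]; on the tower rendering of the cell
(`Howard2004.AdicTower`, `H¹(K_v, 𝐓) = lim_k H¹(K_v, 𝐓_k)`, `DVRKolyvaginBound` docstring) the level-`k` condition at
a place `w ∈ Σ` is therefore the group of `k`-th components of the reduction-compatible families `(x_j)_j` of local
classes with `x_j` in the level-`j` CORE at every `j` (ordinary core at `w ∣ p`, everything at `w ∤ p`) — the image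
of `lim_j` of the cores, which IS the image of the compact condition by Kőnig's lemma (finite levels).  This is the
D1 road's `Tower.levelCondition` WITHOUT its `p`-power saturation (the D1 condition `F_𝔮` is propagated from
`V_𝔮 = T_𝔮 ⊗ ℚ_p`, hence saturated; `𝓕_Λ` is defined on `𝐓` itself).

CONTENT (all generic in the module tower `(M_k, ρ_k, t_k)` and the antitone family of open ideals `I_•` of
`Λ = ℤ_p⟦T⟧`):
* §1 `Tower.exactFamilies red C` = `{x compatible | ∀ j, x_j ∈ C_j}` and the **exact level condition**
  `Tower.exactLevelCondition red C k = {x_k | x ∈ exactFamilies}`; `≤ levelCondition` (it is the `a = 0` part of the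
  saturation), `≤ C k`, monotone in `C`, `= levelCondition` for `C = ⊤`, and the COMPATIBILITY
  `(exactLevelCondition (k+1)).map (red k) = exactLevelCondition k` (so the family of level conditions is the
  reduction-compatible family Howard's `CoeffTowerSetting`/`SatisfiesH.cond_red` speak of).
* §2 the local towers `ZpExtension.coeffLocalRed v k : H¹(K_v, 𝐓_{k+1}) → H¹(K_v, 𝐓_k)` of `coeffAdicTower` and
  `localization ∘ redH1 = coeffLocalRed ∘ localization`.
* §3 at `v ∣ p`, for an `OrdinaryFiltration ρ t v` (D1's structure: `Fil_v M_k ≤ M_k`, `Γ_{K_v}`-stable, compatible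
  with `t`; the curve's instance is `WeierstrassCurve.ordinaryFiltrationAt`, Howard Def. 2.2.5): the plus part
  `coeffFil = (Λ/I_k) ⊗ Fil_v M_k ≤ 𝐓_k` (stable under the twisted local action) and the level-`k` ordinary CORE
  `coeffOrdinaryCore = ker(H¹(K_v, 𝐓_k) → H¹(K_v, 𝐓_k/𝐓_k⁺))` (`=` the printed `im H¹(K_v, 𝐓_k⁺)` by exactness at
  the finite level; the tree's `strictSubgroup`, D1's `ordinaryCore` shape).
* §4 **`ZpExtension.coeffSelmerStructure … S Φ k : SelmerStructure (𝐓_k)`** — `𝓕_Λ` at level `k`: `⊤` at `∞`; at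
  `v ∣ p` the exact level condition of the ordinary cores; at `v ∈ S`, `v ∤ p` (the bad places) the exact level
  condition of the cores `⊤` («`H¹(K_w, 𝐓)` else», propagated: NOT all of `H¹(K_w, 𝐓_k)` in general); at every other
  finite place the unramified condition.  Unfolding lemmas per case; `IsUnramifiedOutside` / Howard's
  `IsHowardSelmerStructure` for `Σ = ∞ ∪ S'` (`S' ⊇ S ∪ {v ∣ p} ∪ {ramified}`); the reduction compatibilities
  `coeffSelmerStructure_map_coeffLocalRed_le` at the places of `Σ`.
* §5 **`ZpExtension.coeffSelmerTriple`** — `(𝐓_k, 𝓕_Λ, 𝓛)` as a `Howard2004.SelmerTriple` for a prime set `𝓛` inside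
  `𝓛₀` of the level and disjoint from `Σ` (parameters with their two hypotheses at this generic layer; the curve's
  assembly pins `𝓛 = 𝓛₁(𝐓) = 𝓛_E`).
NOT here: the curve (`E[p^k]`, `torsionFilAt`, conductor), the Kolyvagin-quotient presentations / finite–singular
slots / `rq` making a `Howard2004.CoeffTowerSetting` (sequel `ZpExtensionShapiroSetting`), any statement about Selmer
groups.  BSD is not proved by any of this.

References: [Howard2004HeegnerKolyvagin] Def. 1.1.1, 1.1.3, 1.1.10, Rem. 1.2.4, Def. 2.2.5–2.2.6 (arXiv:1202.6340
pp. 5–7, p0016 L84–110); [CastellaGrossiLeeSkinner2022] §3.1 (Selmer structures, Σ), §3.4 (𝓕_Λ on 𝐓; v2 TeX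
L2102–2108); [MazurRubinMemoirs2004] Def. 1.1.1, Example 1.1.2; [SerreGaloisCohomology1997] I §2.2, II §1, II §6.1.
-/

noncomputable section

open scoped TensorProduct ContRepresentation
open Field IsDedekindDomain

universe u

namespace Literature.NumberTheory.EllipticCurves

open Literature.NumberTheory.GaloisRepresentations
open Literature.NumberTheory.GaloisRepresentations.DiscreteGaloisModule (SelmerStructure)
open scoped NumberField

/-! ## §1 Exact (unsaturated) families and level conditions of a tower of abelian groups -/

namespace Tower

variable {H : ℕ → Type u} [∀ j, AddCommGroup (H j)] (red : ∀ j, H (j + 1) →+ H j)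

/-- **The exact families** of a tower with respect to level-wise cores `C_j ≤ H_j`: the compatible families
`x = (x_j)_j` (`red_j x_{j+1} = x_j`) with `x_j ∈ C_j` at EVERY level — the inverse limit `lim_j C_j` inside
`lim_j H_j` (for `H_j = H¹(K_v, 𝐓_j)` and `C_j = im H¹(K_v, 𝐓_j⁺)`: Howard's `H¹_{𝓕_Λ}(K_v, 𝐓) = im H¹(K_v, Fil_v 𝐓)`
read on the tower; the `a = 0` part of the D1 road's `saturatedFamilies`).
[cite: Howard2004HeegnerKolyvagin, Def. 2.2.6 (arXiv Def. 3.2.6, p0016 L104–110) with §1.6 (arXiv p. 12, L29–33: H¹(K, T) = lim)]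
[cite: SerreGaloisCohomology1997, Ch. I §2.2 (cohomology with compact coefficients as a limit)] -/
def exactFamilies (C : ∀ j, AddSubgroup (H j)) : AddSubgroup (Π j, H j) :=
  compatibleFamilies red ⊓ AddSubgroup.pi Set.univ C

/-- Membership in `exactFamilies`: compatible, and in the core at every level.
[cite: Howard2004HeegnerKolyvagin, Def. 2.2.6 (arXiv p0016 L104–110)] -/
@[simp]
theorem mem_exactFamilies_iff (C : ∀ j, AddSubgroup (H j)) (x : Π j, H j) :
    x ∈ exactFamilies red C ↔ (∀ j, red j (x (j + 1)) = x j) ∧ ∀ j, x j ∈ C j := by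
  simp [exactFamilies, AddSubgroup.mem_inf, AddSubgroup.mem_pi]

/-- Exact families are compatible families. [cite: Howard2004HeegnerKolyvagin, Def. 2.2.6] -/
theorem exactFamilies_le_compatibleFamilies (C : ∀ j, AddSubgroup (H j)) :
    exactFamilies red C ≤ compatibleFamilies red := inf_le_left

/-- Exact families are saturated families (exponent `a = 0`): `𝓕_Λ ⊆` its `p`-saturation.
[cite: Howard2004HeegnerKolyvagin, Def. 2.1.1 and Def. 2.2.6 (propagation from T vs from V)] -/
theorem exactFamilies_le_saturatedFamilies (p : ℕ) (C : ∀ j, AddSubgroup (H j)) :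
    exactFamilies red C ≤ saturatedFamilies red p C := by
  intro x hx
  rw [mem_exactFamilies_iff] at hx
  exact (mem_saturatedFamilies_iff red p C x).2 ⟨hx.1, 0, fun j ↦ by simpa using hx.2 j⟩

/-- Exact families are monotone in the cores. [cite: Howard2004HeegnerKolyvagin, Def. 1.1.10 (the partial order F ≤ F')] -/
theorem exactFamilies_mono {C C' : ∀ j, AddSubgroup (H j)} (h : ∀ j, C j ≤ C' j) :
    exactFamilies red C ≤ exactFamilies red C' := by
  intro x hx
  rw [mem_exactFamilies_iff] at hx ⊢
  exact ⟨hx.1, fun j ↦ h j (hx.2 j)⟩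

/-- **The exact level-`k` condition** `{x_k | x an exact family} ≤ H_k`: the compact condition `lim_j C_j ≤ lim_j H_j`
PROPAGATED TO THE LEVEL `k` (image under `x ↦ x_k`; Howard Def. 1.1.3 / Rem. 1.2.4 (iii): the condition on `T/IT`
is the image of the condition on `T`).
[cite: Howard2004HeegnerKolyvagin, Def. 1.1.3 and Rem. 1.2.4 (iii) (arXiv p. 5 L93–99, p. 7 L19–27)] -/
def exactLevelCondition (C : ∀ j, AddSubgroup (H j)) (k : ℕ) : AddSubgroup (H k) :=
  (exactFamilies red C).map (Pi.evalAddMonoidHom H k)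

/-- Membership in the exact level condition: `y = x_k` for an exact family `x`.
[cite: Howard2004HeegnerKolyvagin, Def. 1.1.3 (arXiv p. 5, L93–99)] -/
theorem mem_exactLevelCondition_iff (C : ∀ j, AddSubgroup (H j)) (k : ℕ) (y : H k) :
    y ∈ exactLevelCondition red C k ↔ ∃ x ∈ exactFamilies red C, x k = y := by
  simp [exactLevelCondition, AddSubgroup.mem_map]

/-- The `k`-th component of an exact family lies in the exact level-`k` condition.
[cite: Howard2004HeegnerKolyvagin, Def. 1.1.3] -/
theorem apply_mem_exactLevelCondition (C : ∀ j, AddSubgroup (H j)) {x : Π j, H j}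
    (hx : x ∈ exactFamilies red C) (k : ℕ) : x k ∈ exactLevelCondition red C k :=
  (mem_exactLevelCondition_iff red C k (x k)).2 ⟨x, hx, rfl⟩

/-- A compatible family in the cores at every level has all its components in the exact level conditions.
[cite: Howard2004HeegnerKolyvagin, Def. 1.1.3 and Def. 2.2.6] -/
theorem mem_exactLevelCondition_of_forall_mem (C : ∀ j, AddSubgroup (H j)) {x : Π j, H j}
    (hx : ∀ j, red j (x (j + 1)) = x j) (hC : ∀ j, x j ∈ C j) (k : ℕ) : x k ∈ exactLevelCondition red C k :=
  apply_mem_exactLevelCondition red C ((mem_exactFamilies_iff red C x).2 ⟨hx, hC⟩) k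

/-- **The exact level condition lies inside the core of its own level** (unlike its `p`-saturation).
[cite: Howard2004HeegnerKolyvagin, Def. 2.2.6 (arXiv p0016 L104–110)] -/
theorem exactLevelCondition_le (C : ∀ j, AddSubgroup (H j)) (k : ℕ) : exactLevelCondition red C k ≤ C k := by
  rintro y hy
  obtain ⟨x, hx, rfl⟩ := (mem_exactLevelCondition_iff red C k y).1 hy
  exact ((mem_exactFamilies_iff red C x).1 hx).2 k

/-- The exact level condition is contained in the D1 road's (saturated) level condition, any `p`.
[cite: Howard2004HeegnerKolyvagin, Def. 2.1.1 and Def. 2.2.6 (𝓕 on T versus propagated from V)] -/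
theorem exactLevelCondition_le_levelCondition (p : ℕ) (C : ∀ j, AddSubgroup (H j)) (k : ℕ) :
    exactLevelCondition red C k ≤ levelCondition red p C k :=
  AddSubgroup.map_mono (exactFamilies_le_saturatedFamilies red p C)

/-- The exact level conditions are monotone in the cores. [cite: Howard2004HeegnerKolyvagin, Def. 1.1.10 (F ≤ F')] -/
theorem exactLevelCondition_mono {C C' : ∀ j, AddSubgroup (H j)} (h : ∀ j, C j ≤ C' j) (k : ℕ) :
    exactLevelCondition red C k ≤ exactLevelCondition red C' k :=
  AddSubgroup.map_mono (exactFamilies_mono red h)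

/-- With every core the whole group, the exact level condition is the group of `k`-th components of compatible
families — the image of `H¹(K_v, 𝐓) → H¹(K_v, 𝐓_k)` («`H¹(K_w, 𝐓)` else», propagated); it coincides with the D1
road's `levelCondition` for `C = ⊤` (`mem_levelCondition_top_iff`).
[cite: CastellaGrossiLeeSkinner2022, §3.4 (arXiv v2 TeX L2102–2108: H¹(K_w, 𝐓) for w ∤ p)] [cite: Howard2004HeegnerKolyvagin, Rem. 1.2.4 (iii)] -/
theorem mem_exactLevelCondition_top_iff (k : ℕ) (y : H k) :
    y ∈ exactLevelCondition red (fun _ ↦ ⊤) k ↔ ∃ x ∈ compatibleFamilies red, x k = y := by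
  rw [mem_exactLevelCondition_iff]
  constructor
  · rintro ⟨x, hx, rfl⟩
    exact ⟨x, exactFamilies_le_compatibleFamilies red _ hx, rfl⟩
  · rintro ⟨x, hx, rfl⟩
    exact ⟨x, (mem_exactFamilies_iff red _ x).2 ⟨(mem_compatibleFamilies_iff red x).1 hx,
      fun j ↦ AddSubgroup.mem_top _⟩, rfl⟩

/-- For the cores `⊤` the exact and the saturated level conditions agree.
[cite: Howard2004HeegnerKolyvagin, Def. 1.1.1 (relaxed condition) and Rem. 1.2.4 (iii)] -/
theorem exactLevelCondition_top_eq_levelCondition_top (p : ℕ) (k : ℕ) :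
    exactLevelCondition red (fun _ ↦ (⊤ : AddSubgroup (H _))) k = levelCondition red p (fun _ ↦ ⊤) k := by
  ext y
  rw [mem_exactLevelCondition_top_iff, mem_levelCondition_top_iff]

/-- **Compatibility of the exact level conditions under reduction**: `red_k` maps the level-`(k+1)` condition ONTO
the level-`k` condition (both are the components of the same exact families) — Howard's «level `k`'s condition is
the reduction of level `k+1`'s» (`SatisfiesH.cond_red` shape).
[cite: Howard2004HeegnerKolyvagin, Def. 1.1.3 and §1.6 (arXiv p. 5 L93–99, p. 11 L33–38)] -/
theorem map_red_exactLevelCondition (C : ∀ j, AddSubgroup (H j)) (k : ℕ) :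
    (exactLevelCondition red C (k + 1)).map (red k) = exactLevelCondition red C k := by
  ext y
  constructor
  · rintro ⟨z, hz, rfl⟩
    obtain ⟨x, hx, rfl⟩ := (mem_exactLevelCondition_iff red C (k + 1) z).1 hz
    rw [((mem_exactFamilies_iff red C x).1 hx).1 k]
    exact apply_mem_exactLevelCondition red C hx k
  · intro hy
    obtain ⟨x, hx, rfl⟩ := (mem_exactLevelCondition_iff red C k y).1 hy
    exact ⟨x (k + 1), apply_mem_exactLevelCondition red C hx (k + 1), ((mem_exactFamilies_iff red C x).1 hx).1 k⟩

/-- In particular `red_k` maps the level-`(k+1)` condition into the level-`k` condition.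
[cite: Howard2004HeegnerKolyvagin, Def. 1.1.3 and §1.6 (arXiv p. 11, L33–38)] -/
theorem red_mem_exactLevelCondition (C : ∀ j, AddSubgroup (H j)) {k : ℕ} {y : H (k + 1)}
    (hy : y ∈ exactLevelCondition red C (k + 1)) : red k y ∈ exactLevelCondition red C k := by
  rw [← map_red_exactLevelCondition red C k]
  exact ⟨y, hy, rfl⟩

end Tower

/-! ## §2 The local towers of `coeffAdicTower` -/

namespace ZpExtension

open Literature.NumberTheory.GaloisCohomology.Howard2004
open IsLocalRing

variable {K : Type} [Field K] [NumberField K] {p : ℕ} [hp : Fact p.Prime] (κ : ZpExtension K p)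
  {M : ℕ → Type} [∀ k, AddCommGroup (M k)] [∀ k, TopologicalSpace (M k)] [∀ k, DiscreteTopology (M k)]
  (ρ : ∀ k, DiscreteGaloisModule K (M k))
  (t : ∀ k, (ρ (k + 1)).toContRepresentation →ⁱL (ρ k).toContRepresentation)
  (I : ℕ → Ideal (IwasawaAlgebra p)) (hI : ∀ k, I (k + 1) ≤ I k)
  (J : ℕ → ℕ) (hJ : ∀ k, ((1 + PowerSeries.X : IwasawaAlgebra p) ^ (p ^ J k) - 1) ∈ I k)
  (e : ℕ → ℕ) (he : ∀ k, maximalIdeal (IwasawaAlgebra p) ^ e k ≤ I k)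
  (ht : ∀ k, Function.Surjective (t k))

/-- **The local tower at a place `v`**: `H¹(K_v, 𝐓_{k+1}) → H¹(K_v, 𝐓_k)` induced by the reduction
`M_{k+1} ⊗ Λ/I_{k+1} → M_k ⊗ Λ/I_k` of `coeffAdicTower` restricted to `Γ_{K_v}` — the maps along which
`H¹(K_v, 𝐓) = lim_k H¹(K_v, 𝐓_k)`. [cite: Howard2004HeegnerKolyvagin, §2.2 Def. 2.2.3 and Lemma 2.2.7 (arXiv p0016)] [cite: SerreGaloisCohomology1997, Ch. II §1] -/
def coeffLocalRed (v : NumberField.Place K) (k : ℕ) :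
    galoisCohomology (((κ.coeffAdicTower ρ t I hI J hJ e he ht).ρ (k + 1)).toLocal v) 1 →+
      galoisCohomology (((κ.coeffAdicTower ρ t I hI J hJ e he ht).ρ k).toLocal v) 1 :=
  galoisCohomology.map (DiscreteGaloisModule.localMap (κ.coeffLevelReduce ρ t I hI J hJ k) v) 1

/-- **Localisation is a map of towers**: `loc_v ∘ redH1_k = coeffLocalRed_k ∘ loc_v`.
[cite: SerreGaloisCohomology1997, Ch. I §2.4 and Ch. II §6.1] [cite: Howard2004HeegnerKolyvagin, Lemma 2.2.7] -/
theorem localization_redH1_coeffAdicTower (v : NumberField.Place K) (k : ℕ)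
    (x : galoisCohomology ((κ.coeffAdicTower ρ t I hI J hJ e he ht).ρ (k + 1)) 1) :
    galoisCohomology.localization ((κ.coeffAdicTower ρ t I hI J hJ e he ht).ρ k) v 1
        ((κ.coeffAdicTower ρ t I hI J hJ e he ht).redH1 k x) =
      κ.coeffLocalRed ρ t I hI J hJ e he ht v k
        (galoisCohomology.localization ((κ.coeffAdicTower ρ t I hI J hJ e he ht).ρ (k + 1)) v 1 x) := by
  rw [redH1_coeffAdicTower]
  exact DiscreteGaloisModule.localization_map_one _ v x

/-- The localisations of a family in `lim_k H¹(K, 𝐓_k)` form a compatible family of the local tower at `v`.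
[cite: Howard2004HeegnerKolyvagin, §2.2 and Lemma 2.2.7] [cite: SerreGaloisCohomology1997, Ch. II §6.1] -/
theorem localization_mem_compatibleFamilies_of_mem_limitH1 (v : NumberField.Place K)
    {x : ∀ k, galoisCohomology ((κ.coeffAdicTower ρ t I hI J hJ e he ht).ρ k) 1}
    (hx : x ∈ (κ.coeffAdicTower ρ t I hI J hJ e he ht).limitH1) :
    (fun k ↦ galoisCohomology.localization ((κ.coeffAdicTower ρ t I hI J hJ e he ht).ρ k) v 1 (x k)) ∈
      Tower.compatibleFamilies (κ.coeffLocalRed ρ t I hI J hJ e he ht v) := by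
  rw [Tower.mem_compatibleFamilies_iff]
  intro k
  rw [← localization_redH1_coeffAdicTower, hx k]

/-! ## §3 The plus part `(Λ/I_k) ⊗ Fil_v M_k` and the ordinary core at `v ∣ p` -/

section Ordinary

variable {κ ρ t} {v : HeightOneSpectrum (𝓞 K)} (Φ : OrdinaryFiltration ρ t v)

/-- **The twisted plus part `𝐓_k⁺ = (Λ/I_k) ⊗ Fil_v M_k ≤ 𝐓_k = (Λ/I_k) ⊗ M_k`** (Howard Def. 2.2.5:
`Fil_v 𝐓 = lim← Ind_{K_n/K} Fil_v T`, i.e. `Fil_v T ⊗ Λ` under `𝐓 ≅ T ⊗ Λ`): the `ℤ`-span of the pure tensors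
`c ⊗ a`, `a ∈ Fil_v M_k`. [cite: Howard2004HeegnerKolyvagin, Def. 2.2.5 (arXiv Def. 3.2.5, p0016 L84–100)] [cite: CastellaGrossiLeeSkinner2022, §3.4 (Fil_w⁺ 𝐓 := Fil_w⁺(T_pE) ⊗ Λ)] -/
def coeffFil (k : ℕ) : Submodule ℤ (CoeffLevel p I M k) :=
  Submodule.span ℤ {x | ∃ (c : IwasawaAlgebra p ⧸ I k) (a : M k), a ∈ Φ.fil k ∧
    x = (QuotTwisted.tmul c a : QuotTwisted (IwasawaAlgebra p ⧸ I k) (M k))}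

/-- Pure tensors `c ⊗ a` with `a ∈ Fil_v M_k` lie in the plus part. [cite: Howard2004HeegnerKolyvagin, Def. 2.2.5] -/
theorem tmul_mem_coeffFil (k : ℕ) (c : IwasawaAlgebra p ⧸ I k) {a : M k} (ha : a ∈ Φ.fil k) :
    ((QuotTwisted.tmul c a : QuotTwisted (IwasawaAlgebra p ⧸ I k) (M k)) : CoeffLevel p I M k) ∈
      coeffFil I Φ k :=
  Submodule.subset_span ⟨c, a, ha, rfl⟩

/-- **The plus part is stable under the twisted LOCAL action**: `σ ∈ Γ_{K_v}` sends `c ⊗ a` to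
`(u^{κ(σ)} c) ⊗ ρ(σ) a`, a pure tensor with second factor in `Fil_v M_k` (`Φ.smul_mem`).
[cite: Howard2004HeegnerKolyvagin, Def. 2.2.5 (Fil_v 𝐓 is a G_{K_v}-submodule)] -/
theorem coeffFil_le_comap (k : ℕ) (σ : absoluteGaloisGroup (v.adicCompletion K)) :
    coeffFil I Φ k ≤ (coeffFil I Φ k).comap
      (GaloisRep.toLocal v ((κ.coeffAdicTower ρ t I hI J hJ e he ht).ρ k) σ) := by
  rw [coeffFil, Submodule.span_le]
  rintro x ⟨c, a, ha, rfl⟩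
  rw [SetLike.mem_coe, Submodule.mem_comap, GaloisRep.toLocal_apply]
  change κ.coeffTwist (ρ k) (coeffLevelUnit I k) (J k) (mk_one_add_X_pow_prime_pow_eq_one (I k) (hJ k)) _
      (QuotTwisted.tmul c a) ∈ coeffFil I Φ k
  rw [QuotTwisted.tmul, κ.coeffTwist_apply_tmul]
  exact tmul_mem_coeffFil I Φ k _ (Φ.smul_mem k σ a ha)

/-- **The level-`k` ordinary CORE at `v ∣ p`**: `ker (H¹(K_v, 𝐓_k) → H¹(K_v, 𝐓_k/𝐓_k⁺))`, which by exactness of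
`H¹(K_v, 𝐓_k⁺) → H¹(K_v, 𝐓_k) → H¹(K_v, 𝐓_k/𝐓_k⁺)` at the FINITE level `k` IS the printed
`im (H¹(K_v, Fil_v 𝐓_k) → H¹(K_v, 𝐓_k))` (the tree's `strictSubgroup`; D1's `ordinaryCore` shape, so that the
morphism `𝐓_k → T_𝔮/p^k` of STUB 2 compares like with like).
[cite: Howard2004HeegnerKolyvagin, Def. 2.2.6 (arXiv Def. 3.2.6, p0016 L104–110)] [cite: CastellaGrossiLeeSkinner2022, §3.4 (arXiv v2 TeX L2102–2108)] [cite: GreenbergLNM1716, §2 (ordinary condition via F⁺)] -/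
def coeffOrdinaryCore (k : ℕ) :
    AddSubgroup (galoisCohomology (((κ.coeffAdicTower ρ t I hI J hJ e he ht).ρ k).toLocal (Sum.inr v)) 1) :=
  DiscreteGaloisModule.strictSubgroup (GaloisRep.toLocal v ((κ.coeffAdicTower ρ t I hI J hJ e he ht).ρ k))
    (coeffFil I Φ k) (coeffFil_le_comap I hI J hJ e he ht Φ k)

/-- Membership in the ordinary core: the class dies in `H¹(K_v, 𝐓_k/𝐓_k⁺)`.
[cite: Howard2004HeegnerKolyvagin, Def. 2.2.6] -/
theorem mem_coeffOrdinaryCore_iff (k : ℕ)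
    (c : galoisCohomology (((κ.coeffAdicTower ρ t I hI J hJ e he ht).ρ k).toLocal (Sum.inr v)) 1) :
    c ∈ coeffOrdinaryCore I hI J hJ e he ht Φ k ↔
      DiscreteGaloisModule.quotientMap (GaloisRep.toLocal v ((κ.coeffAdicTower ρ t I hI J hJ e he ht).ρ k))
        (coeffFil I Φ k) (coeffFil_le_comap I hI J hJ e he ht Φ k) 1 c = 0 :=
  Iff.rfl

end Ordinary

/-! ## §4 `𝓕_Λ` at level `k` -/

section Selmer

open scoped Classical in
/-- **The Selmer structure `𝓕_Λ` on the level `𝐓_k = M_k ⊗ (Λ/I_k)(χ)` of the `Λ`-adic tower**, for a finite set `S`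
of finite places (the places where `𝐓` is ramified, away from `p`: for `E`, the primes above `N`) and ordinary data
`Φ v` at `v ∣ p` — Howard's / CGLS's `𝓕_Λ` on `𝐓` PROPAGATED to the level (image of `H¹_{𝓕_Λ}(K_v, 𝐓) = lim`):
* at an infinite place: `⊤` (`Σ ∋ ∞`, no condition; `H¹(ℂ, ·) = 0` for `K` imaginary quadratic);
* at `v ∣ p`: the EXACT level condition of the tower of ORDINARY cores — the image of
  `im{H¹(K_v, Fil_v 𝐓) → H¹(K_v, 𝐓)}` in `H¹(K_v, 𝐓_k)`;
* at `v ∈ S`, `v ∤ p`: the EXACT level condition of the cores `⊤` — the image of `H¹(K_v, 𝐓)` in `H¹(K_v, 𝐓_k)`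
  (CGLS «`H¹(K_w, 𝐓)` else»; for Howard's Def. 2.2.6, unramified at `v ∤ p`, the two agree on `𝐓` — not used);
* at every other finite place: the unramified condition `H¹_ur(K_v, 𝐓_k)` («`H¹_𝓕 = H¹_f = H¹_ur` outside `Σ`»; there
  `𝐓` is unramified and `H¹_ur` is right exact in the coefficients, so this IS the propagated condition).
[cite: CastellaGrossiLeeSkinner2022, §3.4 (arXiv v2 TeX L2102–2108: 𝓕_Λ on 𝐓) with §3.1 (Σ ⊇ {∞, p, ramified}; H¹_f outside)] [cite: Howard2004HeegnerKolyvagin, Def. 2.2.6 and Def. 1.1.3 / Rem. 1.2.4 (iii) (propagation to 𝐓/I𝐓), Def. 1.1.10] -/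
def coeffSelmerStructure (S : Finset (HeightOneSpectrum (𝓞 K)))
    (Φ : ∀ v : HeightOneSpectrum (𝓞 K), ((p : ℕ) : 𝓞 K) ∈ v.asIdeal → OrdinaryFiltration ρ t v) (k : ℕ) :
    SelmerStructure ((κ.coeffAdicTower ρ t I hI J hJ e he ht).ρ k) := fun v ↦
  match v with
  | Sum.inl _ => ⊤
  | Sum.inr v =>
    if hv : ((p : ℕ) : 𝓞 K) ∈ v.asIdeal then
      Tower.exactLevelCondition (κ.coeffLocalRed ρ t I hI J hJ e he ht (Sum.inr v))
        (fun j ↦ coeffOrdinaryCore I hI J hJ e he ht (Φ v hv) j) k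
    else if v ∈ S then
      Tower.exactLevelCondition (κ.coeffLocalRed ρ t I hI J hJ e he ht (Sum.inr v))
        (fun j ↦ (⊤ : AddSubgroup
          (galoisCohomology (((κ.coeffAdicTower ρ t I hI J hJ e he ht).ρ j).toLocal (Sum.inr v)) 1))) k
    else DiscreteGaloisModule.unramifiedSubgroup
      (GaloisRep.toLocal v ((κ.coeffAdicTower ρ t I hI J hJ e he ht).ρ k)) 1

variable (S : Finset (HeightOneSpectrum (𝓞 K)))
  (Φ : ∀ v : HeightOneSpectrum (𝓞 K), ((p : ℕ) : 𝓞 K) ∈ v.asIdeal → OrdinaryFiltration ρ t v) (k : ℕ)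

/-- `𝓕_Λ` at an infinite place: no condition. [cite: CastellaGrossiLeeSkinner2022, §3.1 (Σ ∋ ∞)] -/
@[simp]
theorem coeffSelmerStructure_inl (w : NumberField.InfinitePlace K) :
    κ.coeffSelmerStructure ρ t I hI J hJ e he ht S Φ k (Sum.inl w) = ⊤ :=
  rfl

/-- `𝓕_Λ` at `v ∣ p`: the exact level condition of the ordinary tower («im H¹(K_w, Fil_w⁺ 𝐓)», propagated).
[cite: CastellaGrossiLeeSkinner2022, §3.4 (arXiv v2 TeX L2102–2108)] [cite: Howard2004HeegnerKolyvagin, Def. 2.2.6] -/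
theorem coeffSelmerStructure_inr_of_mem {v : HeightOneSpectrum (𝓞 K)} (hv : ((p : ℕ) : 𝓞 K) ∈ v.asIdeal) :
    κ.coeffSelmerStructure ρ t I hI J hJ e he ht S Φ k (Sum.inr v) =
      Tower.exactLevelCondition (κ.coeffLocalRed ρ t I hI J hJ e he ht (Sum.inr v))
        (fun j ↦ coeffOrdinaryCore I hI J hJ e he ht (Φ v hv) j) k := by
  simp only [coeffSelmerStructure, dif_pos hv]

/-- `𝓕_Λ` at a place of `S` away from `p`: the exact level condition of the cores `⊤` («H¹(K_w, 𝐓) else», propagated).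
[cite: CastellaGrossiLeeSkinner2022, §3.4 (arXiv v2 TeX L2102–2108)] [cite: Howard2004HeegnerKolyvagin, Rem. 1.2.4 (iii)] -/
theorem coeffSelmerStructure_inr_of_mem_of_not_mem {v : HeightOneSpectrum (𝓞 K)}
    (hv : ((p : ℕ) : 𝓞 K) ∉ v.asIdeal) (hvS : v ∈ S) :
    κ.coeffSelmerStructure ρ t I hI J hJ e he ht S Φ k (Sum.inr v) =
      Tower.exactLevelCondition (κ.coeffLocalRed ρ t I hI J hJ e he ht (Sum.inr v))
        (fun j ↦ (⊤ : AddSubgroup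
          (galoisCohomology (((κ.coeffAdicTower ρ t I hI J hJ e he ht).ρ j).toLocal (Sum.inr v)) 1))) k := by
  classical
  simp only [coeffSelmerStructure, dif_neg hv, if_pos hvS]

/-- `𝓕_Λ` at a finite place outside `S ∪ {v ∣ p}`: the unramified condition.
[cite: CastellaGrossiLeeSkinner2022, §3.1 (H¹_f = H¹_ur outside Σ)] [cite: Howard2004HeegnerKolyvagin, Def. 1.1.10 and Def. 2.2.6] -/
theorem coeffSelmerStructure_inr_of_not_mem {v : HeightOneSpectrum (𝓞 K)}
    (hv : ((p : ℕ) : 𝓞 K) ∉ v.asIdeal) (hvS : v ∉ S) :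
    κ.coeffSelmerStructure ρ t I hI J hJ e he ht S Φ k (Sum.inr v) =
      DiscreteGaloisModule.unramifiedSubgroup (GaloisRep.toLocal v ((κ.coeffAdicTower ρ t I hI J hJ e he ht).ρ k)) 1 := by
  classical
  simp only [coeffSelmerStructure, dif_neg hv, if_neg hvS]

/-- At `v ∣ p` the level-`k` condition lies INSIDE the level-`k` ordinary core (a class of `𝓕_Λ` dies in
`H¹(K_v, 𝐓_k/𝐓_k⁺)`). [cite: Howard2004HeegnerKolyvagin, Def. 2.2.6] -/
theorem coeffSelmerStructure_inr_le_coeffOrdinaryCore {v : HeightOneSpectrum (𝓞 K)}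
    (hv : ((p : ℕ) : 𝓞 K) ∈ v.asIdeal) :
    κ.coeffSelmerStructure ρ t I hI J hJ e he ht S Φ k (Sum.inr v) ≤ coeffOrdinaryCore I hI J hJ e he ht (Φ v hv) k := by
  rw [coeffSelmerStructure_inr_of_mem (hv := hv)]
  exact Tower.exactLevelCondition_le _ _ k

/-- **`𝓕_Λ` is unramified outside `∞ ∪ S'`** for every finite set `S'` of finite places containing `S` and the places
above `p` (tree `SelmerStructure.IsUnramifiedOutside`) — by construction.
[cite: Howard2004HeegnerKolyvagin, Def. 1.1.10 (arXiv Def. 2.1.10)] [cite: CastellaGrossiLeeSkinner2022, §3.1] -/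
theorem isUnramifiedOutside_coeffSelmerStructure (S' : Finset (HeightOneSpectrum (𝓞 K)))
    (hS : S ⊆ S') (hpS : ∀ v : HeightOneSpectrum (𝓞 K), ((p : ℕ) : 𝓞 K) ∈ v.asIdeal → v ∈ S') :
    (κ.coeffSelmerStructure ρ t I hI J hJ e he ht S Φ k).IsUnramifiedOutside
      ((Finset.univ : Finset (NumberField.InfinitePlace K)).disjSum S') := by
  refine ⟨fun w ↦ Finset.inl_mem_disjSum.2 (Finset.mem_univ w), fun v hv ↦ ?_⟩
  have hvS' : v ∉ S' := fun h ↦ hv (Finset.inr_mem_disjSum.2 h)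
  exact κ.coeffSelmerStructure_inr_of_not_mem ρ t I hI J hJ e he ht S Φ k (fun h ↦ hvS' (hpS v h))
    (fun h ↦ hvS' (hS h))

/-- **`𝓕_Λ` at level `k` is a Selmer structure in Howard's sense** (`Howard2004.IsHowardSelmerStructure`) for
`Σ = ∞ ∪ S'` whenever `S' ⊇ S`, `S' ∋` every place above `p` and every finite place at which `𝐓_k` is ramified.
[cite: Howard2004HeegnerKolyvagin, Def. 1.1.10 (arXiv Def. 2.1.10, p. 6 L10–24)] [cite: CastellaGrossiLeeSkinner2022, §3.1 (Σ ⊇ {∞, p, ramified})] -/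
theorem isHowardSelmerStructure_coeffSelmerStructure (S' : Finset (HeightOneSpectrum (𝓞 K)))
    (hS : S ⊆ S') (hpS : ∀ v : HeightOneSpectrum (𝓞 K), ((p : ℕ) : 𝓞 K) ∈ v.asIdeal → v ∈ S')
    (hram : ∀ v : HeightOneSpectrum (𝓞 K),
      ¬ GaloisRep.IsUnramifiedAt v ((κ.coeffAdicTower ρ t I hI J hJ e he ht).ρ k) → v ∈ S') :
    IsHowardSelmerStructure p (κ.coeffSelmerStructure ρ t I hI J hJ e he ht S Φ k)
      ((Finset.univ : Finset (NumberField.InfinitePlace K)).disjSum S') where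
  isUnramifiedOutside := κ.isUnramifiedOutside_coeffSelmerStructure ρ t I hI J hJ e he ht S Φ k S' hS hpS
  mem_of_dvd v hv := Finset.inr_mem_disjSum.2 (hpS v hv)
  mem_of_ramified v hv := Finset.inr_mem_disjSum.2 (hram v hv)

/-- **Reduction compatibility of `𝓕_Λ` at the places of `Σ`**: at an infinite place, at `v ∣ p` and at `v ∈ S`,
`coeffLocalRed_k` maps the level-`(k+1)` condition ONTO the level-`k` condition (both are the components of the same
exact families) — the clause «level `k`'s condition is the reduction of level `k+1`'s» of Howard's tower data.
(Outside `Σ` both sides are unramified conditions; the corresponding statement is the right exactness of `H¹_ur`,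
not recorded here.) [cite: Howard2004HeegnerKolyvagin, Def. 1.1.3 and §1.6 (arXiv p. 5 L93–99, p. 11 L33–38)] -/
theorem map_coeffLocalRed_coeffSelmerStructure_inr_of_mem {v : HeightOneSpectrum (𝓞 K)}
    (hv : ((p : ℕ) : 𝓞 K) ∈ v.asIdeal) :
    (κ.coeffSelmerStructure ρ t I hI J hJ e he ht S Φ (k + 1) (Sum.inr v)).map
        (κ.coeffLocalRed ρ t I hI J hJ e he ht (Sum.inr v) k) =
      κ.coeffSelmerStructure ρ t I hI J hJ e he ht S Φ k (Sum.inr v) := by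
  rw [coeffSelmerStructure_inr_of_mem (hv := hv), coeffSelmerStructure_inr_of_mem (hv := hv)]
  exact Tower.map_red_exactLevelCondition
    (H := fun j ↦ galoisCohomology (((κ.coeffAdicTower ρ t I hI J hJ e he ht).ρ j).toLocal (Sum.inr v)) 1)
    (κ.coeffLocalRed ρ t I hI J hJ e he ht (Sum.inr v)) _ k

/-- The same at a place of `S` away from `p`. [cite: Howard2004HeegnerKolyvagin, Def. 1.1.3 and §1.6 (arXiv p. 11, L33–38)] -/
theorem map_coeffLocalRed_coeffSelmerStructure_inr_of_mem_of_not_mem {v : HeightOneSpectrum (𝓞 K)}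
    (hv : ((p : ℕ) : 𝓞 K) ∉ v.asIdeal) (hvS : v ∈ S) :
    (κ.coeffSelmerStructure ρ t I hI J hJ e he ht S Φ (k + 1) (Sum.inr v)).map
        (κ.coeffLocalRed ρ t I hI J hJ e he ht (Sum.inr v) k) =
      κ.coeffSelmerStructure ρ t I hI J hJ e he ht S Φ k (Sum.inr v) := by
  rw [coeffSelmerStructure_inr_of_mem_of_not_mem (hv := hv) (hvS := hvS),
    coeffSelmerStructure_inr_of_mem_of_not_mem (hv := hv) (hvS := hvS)]
  exact Tower.map_red_exactLevelCondition
    (H := fun j ↦ galoisCohomology (((κ.coeffAdicTower ρ t I hI J hJ e he ht).ρ j).toLocal (Sum.inr v)) 1)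
    (κ.coeffLocalRed ρ t I hI J hJ e he ht (Sum.inr v)) _ k

/-- Outside `S ∪ {v ∣ p}` the reduction maps the level-`(k+1)` condition INTO the level-`k` condition (unramified
classes go to unramified classes). [cite: Howard2004HeegnerKolyvagin, Def. 1.1.1 and Lemma 1.1.9 (H¹_ur is functorial)] -/
theorem map_coeffLocalRed_coeffSelmerStructure_inr_of_not_mem_le {v : HeightOneSpectrum (𝓞 K)}
    (hv : ((p : ℕ) : 𝓞 K) ∉ v.asIdeal) (hvS : v ∉ S) :
    (κ.coeffSelmerStructure ρ t I hI J hJ e he ht S Φ (k + 1) (Sum.inr v)).map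
        (κ.coeffLocalRed ρ t I hI J hJ e he ht (Sum.inr v) k) ≤
      κ.coeffSelmerStructure ρ t I hI J hJ e he ht S Φ k (Sum.inr v) := by
  rw [coeffSelmerStructure_inr_of_not_mem (hv := hv) (hvS := hvS),
    coeffSelmerStructure_inr_of_not_mem (hv := hv) (hvS := hvS)]
  rintro _ ⟨x, hx, rfl⟩
  exact DiscreteGaloisModule.map_mem_unramifiedSubgroup _ hx

/-- **`𝓕_Λ` is a reduction-compatible family of Selmer structures on the tower** (`AdicTower.IsCompatibleFamily`:
at every place the level-`(k+1)` condition maps into the level-`k` condition).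
[cite: Howard2004HeegnerKolyvagin, §1.6 (arXiv p. 11 L33–38, p. 12 L29–55)] -/
theorem isCompatibleFamily_coeffSelmerStructure :
    (κ.coeffAdicTower ρ t I hI J hJ e he ht).IsCompatibleFamily (κ.coeffSelmerStructure ρ t I hI J hJ e he ht S Φ) := by
  intro k v
  have hred : ContinuousRep.cohomologyMap (((κ.coeffAdicTower ρ t I hI J hJ e he ht).ρ (k + 1)).toLocal v)
      (((κ.coeffAdicTower ρ t I hI J hJ e he ht).ρ k).toLocal v)
      ((κ.coeffAdicTower ρ t I hI J hJ e he ht).red k).toAddMonoidHom continuous_of_discreteTopology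
      (fun _ x => (κ.coeffAdicTower ρ t I hI J hJ e he ht).red_equivariant k _ x) 1 =
      κ.coeffLocalRed ρ t I hI J hJ e he ht v k := by
    refine AddMonoidHom.ext fun x ↦ ?_
    obtain ⟨φ, rfl⟩ := oneCocycleClass_surjective
      (DiscreteGaloisModule.toTopRep (((κ.coeffAdicTower ρ t I hI J hJ e he ht).ρ (k + 1)).toLocal v)) x
    change ContinuousCohomology.map _ _ 1 _ = ContinuousCohomology.map _ _ 1 _
    erw [map_oneCocycleClass]
  rw [hred]
  rcases v with w | v
  · rw [coeffSelmerStructure_inl]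
    exact le_top
  · by_cases hv : ((p : ℕ) : 𝓞 K) ∈ v.asIdeal
    · exact (κ.map_coeffLocalRed_coeffSelmerStructure_inr_of_mem ρ t I hI J hJ e he ht S Φ k hv).le
    · by_cases hvS : v ∈ S
      · exact (κ.map_coeffLocalRed_coeffSelmerStructure_inr_of_mem_of_not_mem ρ t I hI J hJ e he ht S Φ k hv hvS).le
      · exact κ.map_coeffLocalRed_coeffSelmerStructure_inr_of_not_mem_le ρ t I hI J hJ e he ht S Φ k hv hvS

end Selmer

/-! ## §5 The Selmer triple `(𝐓_k, 𝓕_Λ, 𝓛)` -/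

section Triple

variable (S : Finset (HeightOneSpectrum (𝓞 K)))
  (Φ : ∀ v : HeightOneSpectrum (𝓞 K), ((p : ℕ) : 𝓞 K) ∈ v.asIdeal → OrdinaryFiltration ρ t v)
  (hpS : ∀ v : HeightOneSpectrum (𝓞 K), ((p : ℕ) : 𝓞 K) ∈ v.asIdeal → v ∈ S)
  (hram : ∀ (k : ℕ) (v : HeightOneSpectrum (𝓞 K)),
    ¬ GaloisRep.IsUnramifiedAt v ((κ.coeffAdicTower ρ t I hI J hJ e he ht).ρ k) → v ∈ S)
  (L : Set (HeightOneSpectrum (𝓞 K)))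
  (hL : L ⊆ (κ.coeffAdicTower ρ t I hI J hJ e he ht).degreeTwoPrimes p)
  (hLS : ∀ v ∈ L, v ∉ S)

/-- **The Selmer triple `(𝐓_k, 𝓕_Λ, 𝓛)` on the level `k` of the `Λ`-adic tower** (Howard §1.2: «an object `T` of
`Mod_{R,K}`, a choice of Selmer structure `𝓕` on `T`, and a subset `𝓛 ⊂ 𝓛₀` disjoint from `Σ(𝓕)`»): `𝓕_Λ` at level `k`
(`coeffSelmerStructure`, `S` the finite bad set containing the places above `p` and the ramified places),
`Σ(𝓕_Λ) = ∞ ∪ S`, and a prime set `𝓛` inside `𝓛₀(𝐓) = ⋂_k 𝓛₀(𝐓_k)` and disjoint from `S` (parameters at this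
generic layer; the curve's assembly takes `𝓛 = 𝓛₁(𝐓) = 𝓛_E`).
[cite: Howard2004HeegnerKolyvagin, §1.2 (arXiv p. 6, L96–100) and §2.3 (arXiv p0018 L65: «Define 𝓛 = 𝓛₁(𝐓)»)] [cite: CastellaGrossiLeeSkinner2022, §3.1 (Selmer triples) and Thm. 4.1.1 ((𝐓, 𝓕_Λ, 𝓛_E))] -/
def coeffSelmerTriple (k : ℕ) : SelmerTriple p ((κ.coeffAdicTower ρ t I hI J hJ e he ht).ρ k) where
  cond := κ.coeffSelmerStructure ρ t I hI J hJ e he ht S Φ k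
  Sigma := (Finset.univ : Finset (NumberField.InfinitePlace K)).disjSum S
  isHoward := κ.isHowardSelmerStructure_coeffSelmerStructure ρ t I hI J hJ e he ht S Φ k S
    (Finset.Subset.refl S) hpS (hram k)
  primes := L
  primes_subset := fun _ hv ↦ Set.mem_iInter.mp (hL hv) k
  disjoint := fun v hv hmem ↦ hLS v hv (Finset.inr_mem_disjSum.1 hmem)

/-- The condition of the triple is `𝓕_Λ` at level `k`. [cite: Howard2004HeegnerKolyvagin, Def. 2.2.6] -/
@[simp]
theorem coeffSelmerTriple_cond (k : ℕ) :
    (κ.coeffSelmerTriple ρ t I hI J hJ e he ht S Φ hpS hram L hL hLS k).cond =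
      κ.coeffSelmerStructure ρ t I hI J hJ e he ht S Φ k :=
  rfl

/-- `Σ(𝓕_Λ) = ∞ ∪ S` at every level. [cite: CastellaGrossiLeeSkinner2022, §3.1–§3.2 (Σ = {w ∣ pN} ∪ ∞)] -/
@[simp]
theorem coeffSelmerTriple_Sigma (k : ℕ) :
    (κ.coeffSelmerTriple ρ t I hI J hJ e he ht S Φ hpS hram L hL hLS k).Sigma =
      (Finset.univ : Finset (NumberField.InfinitePlace K)).disjSum S :=
  rfl

/-- The prime set of the triple is `𝓛` at every level. [cite: Howard2004HeegnerKolyvagin, §2.3 (arXiv p0018 L65)] -/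
@[simp]
theorem coeffSelmerTriple_primes (k : ℕ) :
    (κ.coeffSelmerTriple ρ t I hI J hJ e he ht S Φ hpS hram L hL hLS k).primes = L :=
  rfl

end Triple

end ZpExtension

end Literature.NumberTheory.EllipticCurves

end
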